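import Summits.BirchSwinnertonDyer.BirchSwinnertonDyer.Theses.EisensteinPrimes
import Summits.BirchSwinnertonDyer.BirchSwinnertonDyer.Theorems.EisensteinPrimesMazurMCOnCellBMuPartTight
import Summits.BirchSwinnertonDyer.BirchSwinnertonDyer.Theorems.EisensteinPrimesMazurMCOnCellBMuPartTightParity
import Summits.BirchSwinnertonDyer.BirchSwinnertonDyer.Theorems.EisensteinPrimesMazurMCOnCellBLocate
import Summits.BirchSwinnertonDyer.Rank1Residual.X2.IsogenyClassStability
import Summits.BirchSwinnertonDyer.Rank1Residual.X2.RankOneHeegnerExact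
import Literature.NumberTheory.EllipticCurves.TateCurve.NumberFieldUniformization
import Literature.NumberTheory.EllipticCurves.TateCurve.NumberFieldUniformizationTwisted
import HarnessLib

/-!
# Crux `MazurMCOnCellB` (stmt-BirchSwinnertonDyer-19033), line `mudescent`: the crux BY NAME ⟺
# (μ-part ∧ λ-count) at every X2b étale end, and the registered μ-stub = μ-part + Greenberg's
# Conj. 1.11 on X2b — class-wide forms on the route's `PublishedInputs` (helper; closes nothing)

Cell `bsd-eis`, D-0154 width seat `bsd-line-x2-p1-w2` (gen 2), crux 3 (row A10, X2b), skeleton of record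
`Cruxes/MazurMCOnCellB/Lines/mudescent.lean` (`bcae135b…`). Third file of the seat after
`EisensteinPrimesX2AnalyticMuBound` (non-vanishing of the Mazur–Tate–Teitelbaum function at a rank-`0`
pair), `EisensteinPrimesMazurMCOnCellBMuPartTight` (pair level: μ-tolerant route T; at an X2b pair
`X2.MazurMainConjectureAt ⟺ μ-part ∧ λ-count`; `μ_an = 0 ⟺ μ-part ∧ μ(X) = 0`) and
`EisensteinPrimesMazurMCOnCellBMuPartTightParity` (the same in the PARITY shape of the LEAD's skeleton
v3, stub 4 = `stub_lambdaCountParity_offLocus`, stub 1b = Prop. 3.10). This file alone imports the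
route file (it speaks of the crux `EisensteinPrimes.MazurMCOnCellB` and of
`EisensteinPrimes.PublishedInputs` BY NAME); everything it composes is route-independent.

WHAT THIS FILE PROVES (theorems only; every published input a conjunct of `PublishedInputs` by name):
* `mazurMCOnCellB_iff_forall_cellB` — crux ⟺ ∀ X2b pairs `(W, p)`, μ-part ∧ λ-count (file 2 §3 at
  the pair itself; modularity, Wuthrich Thm. 16, Greenberg–Stevens).
* `mazurMCOnCellB_iff_forall_offLocus` — crux ⟺ ∀ X2b pairs `(W₀, p)` OFF the locus
  `HasRamifiedOddLineAt`, μ-part ∧ λ-count: `←` is the registered composition `MazurMCOnCellB_of` with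
  the μ-tolerant route T of file 2 in place of `X2.mazurMainConjectureAt_of_algebraicLambdaGE` (DESCEND
  by `stub_locate`, LANDED p443911; `X2.CellB` transports, `X2.cellB_iff_of_isIsogenous`; MC at
  `(W₀, p)`; ASCEND by `X2.mazurMainConjectureAt_of_isIsogenous`). So the re-cut «stub 3′ := μ-part off
  the locus, stub 4 unchanged» composes to the crux AND is implied by it — no Greenberg surplus.
* `mazurMCOnCellB_iff_forall_offLocus_parity` — the same in the v3 shape (skeleton of record since the
  LEAD's re-cut): granted `PublishedInputs` and Prop. 3.10 (stub 1b), crux ⟺ ∀ X2b étale ends,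
  μ-part ∧ (the conclusion of `stub_lambdaCountParity_offLocus`) — i.e. v3 with stub 3′ := μ-part off
  the locus is EQUIVALENT to the crux.
* `stub_analyticMuZero_offLocus_iff_muPart_and_greenberg` — the registered stub (VERBATIM its
  signature) ⟺ [μ-part at every X2b pair off the locus] ∧ [Greenberg's `μ(X(W₀/ℚ_∞)) = 0` at every
  X2b pair off the locus]: line `mudescent` = (a line EQUIVALENT to the crux) + (Conj. 1.11 at the X2b
  étale ends); the surplus gen 0 exhibited UNDER the crux
  (`EisensteinPrimesMazurMCOnCellBMuEtaleEnd.stub_iff_greenbergMu_of_mazurMCOnCellB`) is isolated here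
  without assuming the crux.

HONEST FRAMING: nothing here proves the stub, the crux, Greenberg's conjecture or BSD for any curve;
0 cells / 0 labels move; the skeleton is not re-registered by this seat. No `def`, no named fact,
no `sorry`. References: [GreenbergLNM1716] Conj. 1.11 (p. 58), Cor. 5.6 (p. 136);
[GreenbergVatsal2000] p. 2 (1)–(2), p. 4–5; [Wuthrich2014] Thm. 16 and Lemma 17 (p. 397);
[PerrinRiou1989Isogenie] Théorème (p. 349); [MazurTateTeitelbaum1986] §I.14.
-/

set_option autoImplicit false

-- `Summit.BirchSwinnertonDyer.BirchSwinnertonDyer.…`: the summit and its single sub-problem share a name (D-0017 layout).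
set_option linter.dupNamespace false

noncomputable section

open scoped Classical MatrixGroups ModularForm

open PowerSeries CongruenceSubgroup WeierstrassCurve
  Literature.NumberTheory.EllipticCurves
  Literature.NumberTheory.EllipticCurves.ModularForms
  Literature.NumberTheory.EllipticCurves.Rank1Residual
  Literature.NumberTheory.EllipticCurves.Wuthrich2014
  Literature.NumberTheory.EllipticCurves.SteinWuthrich2013
  Summit.BirchSwinnertonDyer.Rank1Residual
  Summit.BirchSwinnertonDyer.Rank1Residual.X1.MuLambda
  Summit.BirchSwinnertonDyer.Rank1Residual.X1.TamagawaSqueeze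
  Summit.BirchSwinnertonDyer.BirchSwinnertonDyer.Theses
  Summit.BirchSwinnertonDyer.BirchSwinnertonDyer.Theorems.EisensteinPrimesX2AnalyticMuBound
  Summit.BirchSwinnertonDyer.BirchSwinnertonDyer.Theorems.EisensteinPrimesMazurMCOnCellBMuPartTight
  Summit.BirchSwinnertonDyer.BirchSwinnertonDyer.Theorems.EisensteinPrimesMazurMCOnCellBMuPartTightParity
  Literature.NumberTheory.EllipticCurves.Greenberg1999

open Literature.Barriers.BirchSwinnertonDyer (HasRamifiedOddLineAt)

namespace Summit.BirchSwinnertonDyer.BirchSwinnertonDyer.Theorems.EisensteinPrimesMazurMCOnCellBMuPartTightCrux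

/-- **The crux, TIGHT and class-wide (every X2b pair).** Granted the route's `PublishedInputs`
(conjuncts used: modularity, Wuthrich Thm. 16, Greenberg–Stevens):
`MazurMCOnCellB ⟺ ∀ X2b pairs (W, p), μ-part(W, p) ∧ λ-count(W, p)` (file 2 §3 at the pair itself,
both directions — no descent needed in this form).
[cite: Wuthrich2014, Thm. 16 (p. 397)] [cite: GreenbergVatsal2000, p. 4–5] -/
theorem mazurMCOnCellB_iff_forall_cellB (hP : EisensteinPrimes.PublishedInputs) :
    EisensteinPrimes.MazurMCOnCellB ↔
      ∀ (W : WeierstrassCurve ℚ) [W.IsElliptic] [W.IsGloballyMinimal] (p : ℕ) [Fact p.Prime],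
        X2.CellB W p →
        ((∀ (κ : ZpExtension ℚ p) (γ : Field.absoluteGaloisGroup ℚ),
          κ.IsCyclotomic → κ.IsTopGenerator γ → IsCyclotomicVariable p γ →
          ∀ {N : ℕ} [NeZero N] (f : CuspForm (Gamma0 N) 2), IsNewformOf W f →
          ∀ (ϖ : ℚ), (ϖ : ℝ) * W.realPeriodRat = plusPeriod f →
          ∀ (L : PowerSeries ℚ_[p]),
            (W.HasSplitMultiplicativeReductionAtPrime p → IsSplitMultPAdicLFunctionOf f p L) →
            (¬ W.HasSplitMultiplicativeReductionAtPrime p → IsMultPAdicLFunctionOf f p (-1) L) →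
          ∀ (D : W.SelmerDualData κ γ) (g G : IwasawaAlgebra p), D.charIdeal = Ideal.span {g} →
            iwasawaToPowerSeries p G = PowerSeries.C ((ϖ : ℚ) : ℚ_[p]) * L → mu G ≤ mu g) ∧
        ∃ n k : ℕ, X2.AnalyticLambdaEq W p n ∧ AlgebraicLambdaGE W p k ∧
          (¬ W.HasSplitMultiplicativeReductionAtPrime p → n ≤ k) ∧
          (W.HasSplitMultiplicativeReductionAtPrime p → n ≤ k + 1)) := by
  have hpar := hP.2.2.2.2.1
  have hWu := hP.2.2.2.2.2.2.2.2.2.2.2.2.2.2.1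
  have hGS := hP.2.2.2.2.2.2.2.2.2.2.2.2.2.2.2.2.2.2.2
  unfold EisensteinPrimes.MazurMCOnCellB
  exact ⟨fun h W _ _ p _ hc ↦
      (cellB_mazurMainConjectureAt_iff_muPart_and_lambdaCount hWu hpar (hGS W p) hc).mp (h W p hc),
    fun h W _ _ p _ hc ↦
      (cellB_mazurMainConjectureAt_iff_muPart_and_lambdaCount hWu hpar (hGS W p) hc).mpr (h W p hc)⟩

/-- **The crux, TIGHT, in the skeleton's shape (every X2b ÉTALE END).** Granted `PublishedInputs`:
`MazurMCOnCellB ⟺ ∀ X2b pairs (W₀, p) OFF the locus `HasRamifiedOddLineAt`, μ-part(W₀, p) ∧ λ-count(W₀, p)`.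
`←` is the registered composition `MazurMCOnCellB_of` of line `mudescent` with the μ-tolerant route T
of §1 in place of `X2.mazurMainConjectureAt_of_algebraicLambdaGE`: DESCEND by `stub_locate`
(LANDED p443911) to `W₀`, `X2.CellB` transports (`X2.cellB_iff_of_isIsogenous`), MC at `(W₀, p)` by
file 2 §1 (non-vanishing from `r_an(W₀) = 0`), ASCEND along `W₀ ∼ W` (`X2.mazurMainConjectureAt_of_isIsogenous`:
Wuthrich, Stein–Wuthrich + heights, GZK, modularity, Cassels, Greenberg–Stevens). So a re-cut of the
skeleton with stub 3′ := «μ-part off the locus» (instead of `μ_an = 0` off the locus) and stub 4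
unchanged composes to the crux AND is implied by it: no Greenberg surplus.
[cite: GreenbergLNM1716, Conj. 1.11 (p. 58) and Cor. 5.6 (p. 136)] [cite: PerrinRiou1989Isogenie, Théorème (p. 349)]
[cite: Wuthrich2014, Thm. 16 and Lemma 17 (p. 397)] -/
theorem mazurMCOnCellB_iff_forall_offLocus (hP : EisensteinPrimes.PublishedInputs) :
    EisensteinPrimes.MazurMCOnCellB ↔
      ∀ (W₀ : WeierstrassCurve ℚ) [W₀.IsElliptic] [W₀.IsGloballyMinimal] (p : ℕ) [Fact p.Prime],
        X2.CellB W₀ p → ¬ HasRamifiedOddLineAt W₀ p →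
        ((∀ (κ : ZpExtension ℚ p) (γ : Field.absoluteGaloisGroup ℚ),
          κ.IsCyclotomic → κ.IsTopGenerator γ → IsCyclotomicVariable p γ →
          ∀ {N : ℕ} [NeZero N] (f : CuspForm (Gamma0 N) 2), IsNewformOf W₀ f →
          ∀ (ϖ : ℚ), (ϖ : ℝ) * W₀.realPeriodRat = plusPeriod f →
          ∀ (L : PowerSeries ℚ_[p]),
            (W₀.HasSplitMultiplicativeReductionAtPrime p → IsSplitMultPAdicLFunctionOf f p L) →
            (¬ W₀.HasSplitMultiplicativeReductionAtPrime p → IsMultPAdicLFunctionOf f p (-1) L) →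
          ∀ (D : W₀.SelmerDualData κ γ) (g G : IwasawaAlgebra p), D.charIdeal = Ideal.span {g} →
            iwasawaToPowerSeries p G = PowerSeries.C ((ϖ : ℚ) : ℚ_[p]) * L → mu G ≤ mu g) ∧
        ∃ n k : ℕ, X2.AnalyticLambdaEq W₀ p n ∧ AlgebraicLambdaGE W₀ p k ∧
          (¬ W₀.HasSplitMultiplicativeReductionAtPrime p → n ≤ k) ∧
          (W₀.HasSplitMultiplicativeReductionAtPrime p → n ≤ k + 1)) := by
  have hCassels := hP.2.1
  have hpar := hP.2.2.2.2.1
  have hnf := hP.2.2.2.2.2.1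
  have hGZK := hP.2.2.2.2.2.2.2.2.2.2.1
  have hWu := hP.2.2.2.2.2.2.2.2.2.2.2.2.2.2.1
  have hJs := hP.2.2.2.2.2.2.2.2.2.2.2.2.2.2.2.1
  have hJn := hP.2.2.2.2.2.2.2.2.2.2.2.2.2.2.2.2.1
  have hHs := hP.2.2.2.2.2.2.2.2.2.2.2.2.2.2.2.2.2.1
  have hHn := hP.2.2.2.2.2.2.2.2.2.2.2.2.2.2.2.2.2.2.1
  have hGS := hP.2.2.2.2.2.2.2.2.2.2.2.2.2.2.2.2.2.2.2
  refine ⟨fun h W₀ _ _ p _ hc₀ _ ↦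
    (cellB_mazurMainConjectureAt_iff_muPart_and_lambdaCount hWu hpar (hGS W₀ p) hc₀).mp
      (by unfold EisensteinPrimes.MazurMCOnCellB at h; exact h W₀ p hc₀), fun h ↦ ?_⟩
  unfold EisensteinPrimes.MazurMCOnCellB
  intro W _ _ p _ hc
  -- DESCEND
  obtain ⟨W₀, _, _, hiso, hoff⟩ := EisensteinPrimesMazurMCOnCellBLocate.stub_locate W p hc
  have hc₀ : X2.CellB W₀ p :=
    (X2.cellB_iff_of_isIsogenous (p := p) TateCurve.Silverman1994_thmV53_tateUniformisation_holds
      TateCurve.Silverman1994_thmV53_corV54_tateUniformisation_holds hiso).mp hc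
  have hp2 : p ≠ 2 := hc₀.2.1.1
  have hred₀ : ¬ W₀.HasIrreducibleModPGaloisRep p := hc₀.2.1.2.1
  have hmult₀ : W₀.HasMultiplicativeReductionAtPrime p := hc₀.2.1.2.2
  have hr₀ : W₀.analyticRank = 0 := hc₀.1
  -- μ-part and λ-count at the étale end, then the μ-tolerant route T at `p ‖ N`
  obtain ⟨hμ₀, n, k, hlam, halg, hkN, hkS⟩ := h W₀ p hc₀ hoff
  have hMC₀ : X2.MazurMainConjectureAt W₀ p :=
    mazurMainConjectureAt_of_muPart_of_lambdaCount hWu W₀ p hp2 hmult₀ hred₀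
      (exists_analyticMuLE_of_analyticRank_eq_zero hpar hp2 (hGS W₀ p) hr₀) hμ₀ hlam halg hkN hkS
  -- ASCEND along `W₀ ∼ W`
  exact X2.mazurMainConjectureAt_of_isIsogenous hWu hJs hJn hHs hHn hGZK hnf hpar hCassels hGS
    hiso.symm_of_charZero p hp2 hmult₀ hred₀ hr₀ hMC₀

/-- **The crux, TIGHT, in the shape of the skeleton v3 (every X2b étale end, PARITY λ-count).**
Granted `PublishedInputs` and Greenberg 1999 Prop. 3.10 (`h310`, the v3 stub 1b):
`MazurMCOnCellB ⟺ ∀ X2b pairs (W₀, p) OFF the locus, μ-part(W₀, p) ∧ (∃ n k, λ_an = n ∧ λ_alg ≥ k ∧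
(¬split → n ≤ k + 1 ∧ Even n) ∧ (split → n ≤ k + 2 ∧ Odd n))` — the right-hand side is the v3 skeleton
with stub 3 replaced by the μ-part (stub 3′) and stub 4 VERBATIM `stub_lambdaCountParity_offLocus`.
`→`: `cellB_mazurMainConjectureAt_iff_muPart_and_lambdaCountParity` at `W₀` itself; `←`: the v3
composition `MazurMCOnCellB_of` with the μ-tolerant parity route T (DESCEND `stub_locate`, MC at `W₀`,
ASCEND `X2.mazurMainConjectureAt_of_isIsogenous`). [cite: GreenbergLNM1716, Prop. 3.10, Conj. 1.11 (p. 58), Cor. 5.6 (p. 136)]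
[cite: Wuthrich2014, Thm. 16 and Lemma 17 (p. 397)] [cite: MazurTateTeitelbaum1986, §I.17] -/
theorem mazurMCOnCellB_iff_forall_offLocus_parity (hP : EisensteinPrimes.PublishedInputs)
    (h310 : prop310_selmerCorank_mod_two_eq_lambdaInvariant) :
    EisensteinPrimes.MazurMCOnCellB ↔
      ∀ (W₀ : WeierstrassCurve ℚ) [W₀.IsElliptic] [W₀.IsGloballyMinimal] (p : ℕ) [Fact p.Prime],
        X2.CellB W₀ p → ¬ HasRamifiedOddLineAt W₀ p →
        ((∀ (κ : ZpExtension ℚ p) (γ : Field.absoluteGaloisGroup ℚ),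
          κ.IsCyclotomic → κ.IsTopGenerator γ → IsCyclotomicVariable p γ →
          ∀ {N : ℕ} [NeZero N] (f : CuspForm (Gamma0 N) 2), IsNewformOf W₀ f →
          ∀ (ϖ : ℚ), (ϖ : ℝ) * W₀.realPeriodRat = plusPeriod f →
          ∀ (L : PowerSeries ℚ_[p]),
            (W₀.HasSplitMultiplicativeReductionAtPrime p → IsSplitMultPAdicLFunctionOf f p L) →
            (¬ W₀.HasSplitMultiplicativeReductionAtPrime p → IsMultPAdicLFunctionOf f p (-1) L) →
          ∀ (D : W₀.SelmerDualData κ γ) (g G : IwasawaAlgebra p), D.charIdeal = Ideal.span {g} →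
            iwasawaToPowerSeries p G = PowerSeries.C ((ϖ : ℚ) : ℚ_[p]) * L → mu G ≤ mu g) ∧
        ∃ n k : ℕ, X2.AnalyticLambdaEq W₀ p n ∧ AlgebraicLambdaGE W₀ p k ∧
          (¬ W₀.HasSplitMultiplicativeReductionAtPrime p → n ≤ k + 1 ∧ Even n) ∧
          (W₀.HasSplitMultiplicativeReductionAtPrime p → n ≤ k + 2 ∧ Odd n)) := by
  have hCassels := hP.2.1
  have hpar := hP.2.2.2.2.1
  have hnf := hP.2.2.2.2.2.1
  have hGZK := hP.2.2.2.2.2.2.2.2.2.2.1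
  have hWu := hP.2.2.2.2.2.2.2.2.2.2.2.2.2.2.1
  have hJs := hP.2.2.2.2.2.2.2.2.2.2.2.2.2.2.2.1
  have hJn := hP.2.2.2.2.2.2.2.2.2.2.2.2.2.2.2.2.1
  have hHs := hP.2.2.2.2.2.2.2.2.2.2.2.2.2.2.2.2.2.1
  have hHn := hP.2.2.2.2.2.2.2.2.2.2.2.2.2.2.2.2.2.2.1
  have hGS := hP.2.2.2.2.2.2.2.2.2.2.2.2.2.2.2.2.2.2.2
  refine ⟨fun h W₀ _ _ p _ hc₀ _ ↦
    (cellB_mazurMainConjectureAt_iff_muPart_and_lambdaCountParity hWu h310 hGZK hpar (hGS W₀ p) hc₀).mp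
      (by unfold EisensteinPrimes.MazurMCOnCellB at h; exact h W₀ p hc₀), fun h ↦ ?_⟩
  unfold EisensteinPrimes.MazurMCOnCellB
  intro W _ _ p _ hc
  -- DESCEND
  obtain ⟨W₀, _, _, hiso, hoff⟩ := EisensteinPrimesMazurMCOnCellBLocate.stub_locate W p hc
  have hc₀ : X2.CellB W₀ p :=
    (X2.cellB_iff_of_isIsogenous (p := p) TateCurve.Silverman1994_thmV53_tateUniformisation_holds
      TateCurve.Silverman1994_thmV53_corV54_tateUniformisation_holds hiso).mp hc
  have hp2 : p ≠ 2 := hc₀.2.1.1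
  have hred₀ : ¬ W₀.HasIrreducibleModPGaloisRep p := hc₀.2.1.2.1
  have hmult₀ : W₀.HasMultiplicativeReductionAtPrime p := hc₀.2.1.2.2
  have hr₀ : W₀.analyticRank = 0 := hc₀.1
  -- the v3 stubs (μ-part, parity λ-count) at the étale end give MC at `(W₀, p)`
  have hMC₀ : X2.MazurMainConjectureAt W₀ p :=
    (cellB_mazurMainConjectureAt_iff_muPart_and_lambdaCountParity hWu h310 hGZK hpar (hGS W₀ p) hc₀).mpr
      (h W₀ p hc₀ hoff)
  -- ASCEND along `W₀ ∼ W`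
  exact X2.mazurMainConjectureAt_of_isIsogenous hWu hJs hJn hHs hHn hGZK hnf hpar hCassels hGS
    hiso.symm_of_charZero p hp2 hmult₀ hred₀ hr₀ hMC₀

/-- **The registered μ-stub of `mudescent`, class-wide, decomposed on the published record.** Granted
`PublishedInputs`: `stub_analyticMuZero_offLocus` (verbatim: `X2.AnalyticMuLE W₀ p 0` at every X2b
pair off the locus) ⟺ [μ-part at every X2b pair off the locus] ∧ [Greenberg's `μ(X(W₀/ℚ_∞)) = 0` at
every X2b pair off the locus, every cyclotomic dual datum]. With `mazurMCOnCellB_iff_forall_offLocus`: the line `mudescent` = (a line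
equivalent to the crux) + (Greenberg's Conj. 1.11 at the X2b étale ends) — the second summand is the
surplus recorded by gen 0 (`…MuEtaleEnd.stub_iff_greenbergMu_of_mazurMCOnCellB`), now isolated
without assuming the crux. [cite: GreenbergLNM1716, Conj. 1.11 (p. 58)] [cite: Wuthrich2014, Thm. 16 (p. 397)]
[cite: GreenbergVatsal2000, p. 2 (1)–(2) and p. 5] -/
theorem stub_analyticMuZero_offLocus_iff_muPart_and_greenberg (hP : EisensteinPrimes.PublishedInputs) :
    (∀ (W₀ : WeierstrassCurve ℚ) [W₀.IsElliptic] [W₀.IsGloballyMinimal] (p : ℕ) [Fact p.Prime],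
        X2.CellB W₀ p → ¬ HasRamifiedOddLineAt W₀ p → X2.AnalyticMuLE W₀ p 0) ↔
      ((∀ (W₀ : WeierstrassCurve ℚ) [W₀.IsElliptic] [W₀.IsGloballyMinimal] (p : ℕ) [Fact p.Prime],
        X2.CellB W₀ p → ¬ HasRamifiedOddLineAt W₀ p →
        ∀ (κ : ZpExtension ℚ p) (γ : Field.absoluteGaloisGroup ℚ),
          κ.IsCyclotomic → κ.IsTopGenerator γ → IsCyclotomicVariable p γ →
          ∀ {N : ℕ} [NeZero N] (f : CuspForm (Gamma0 N) 2), IsNewformOf W₀ f →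
          ∀ (ϖ : ℚ), (ϖ : ℝ) * W₀.realPeriodRat = plusPeriod f →
          ∀ (L : PowerSeries ℚ_[p]),
            (W₀.HasSplitMultiplicativeReductionAtPrime p → IsSplitMultPAdicLFunctionOf f p L) →
            (¬ W₀.HasSplitMultiplicativeReductionAtPrime p → IsMultPAdicLFunctionOf f p (-1) L) →
          ∀ (D : W₀.SelmerDualData κ γ) (g G : IwasawaAlgebra p), D.charIdeal = Ideal.span {g} →
            iwasawaToPowerSeries p G = PowerSeries.C ((ϖ : ℚ) : ℚ_[p]) * L → mu G ≤ mu g) ∧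
      (∀ (W₀ : WeierstrassCurve ℚ) [W₀.IsElliptic] [W₀.IsGloballyMinimal] (p : ℕ) [Fact p.Prime],
        X2.CellB W₀ p → ¬ HasRamifiedOddLineAt W₀ p →
        ∀ (κ : ZpExtension ℚ p) (γ : Field.absoluteGaloisGroup ℚ),
          κ.IsCyclotomic → κ.IsTopGenerator γ → IsCyclotomicVariable p γ →
          ∀ D : W₀.SelmerDualData κ γ, D.mu = 0)) := by
  have hpar := hP.2.2.2.2.1
  have hWu := hP.2.2.2.2.2.2.2.2.2.2.2.2.2.2.1
  have hGS := hP.2.2.2.2.2.2.2.2.2.2.2.2.2.2.2.2.2.2.2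
  have key : ∀ (W₀ : WeierstrassCurve ℚ) [W₀.IsElliptic] [W₀.IsGloballyMinimal] (p : ℕ) [Fact p.Prime],
      X2.CellB W₀ p → _ := fun W₀ _ _ p _ hc₀ ↦
    analyticMuLE_zero_iff_muPart_and_forall_mu_eq_zero hWu hpar (hGS W₀ p) hc₀.2.1.1 hc₀.2.1.2.2
      hc₀.2.1.2.1 hc₀.1
  exact ⟨fun h ↦ ⟨fun W₀ _ _ p _ hc₀ hoff ↦ ((key W₀ p hc₀).mp (h W₀ p hc₀ hoff)).1,
      fun W₀ _ _ p _ hc₀ hoff ↦ ((key W₀ p hc₀).mp (h W₀ p hc₀ hoff)).2⟩,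
    fun ⟨h1, h2⟩ W₀ _ _ p _ hc₀ hoff ↦ (key W₀ p hc₀).mpr ⟨h1 W₀ p hc₀ hoff, h2 W₀ p hc₀ hoff⟩⟩

end Summit.BirchSwinnertonDyer.BirchSwinnertonDyer.Theorems.EisensteinPrimesMazurMCOnCellBMuPartTightCrux

end
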